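import Mathlib
import HarnessLib
import Literature.MathematicalPhysics.QuantumLattice.GrassmannSourceGrading
import Summits.HubbardSuperconductivity.HubbardSuperconductivity.Theorems.KLProgrammeKLRegimeTwoVolumeSourceGradedStep
import Summits.HubbardSuperconductivity.HubbardSuperconductivity.Theorems.KLProgrammeKLRegimeTwoVolumeSubstitutionPushforward

/-!
# Route `KLProgramme` — crux K3, VL child `KLRegimeVolumeLimitV17F2` (stmt-HubbardSuperconductivity-20440), token #24 as a THEOREM ((α′), plan
# (R59an)/(R59aw)): ONE SCALE OF THE ONE-VOLUME SOURCE-PROFILE TOWER — step ∘ re-sectorisation ⊕ 1 ∘ `srcTrunc 3`, the source profile at the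
# next scale bounded by the source profile at this scale with IN-BAND constants only
# (cell gate-hubbard-kl, seat hubbard-kl-k3c5-p3 g10, technique «OS-positivity-free direct assembly»)

The (α′) producer of token #24 «SRC2» is a one-volume induction over the scales `j ≤ n⋆` of the truncated augmented actions
`Ã_j := srcTrunc 3 (map τ_j (effAction (C_j ⊕ 0) Ã_{j−1}))` (k3c4-p1's `GrassmannSourceGrading`: the truncation is exact on the strings with ≤ 2 source
legs, `srcTrunc_map_effAction_srcTrunc`).  This file is ONE SCALE of that induction, generic (labels `Γ₁ × Fin 2 → Γ₂ × Fin 2`, copy `1` = sources,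
`P := (·.2 = 1)`):

* §1 `kernel_map_eq_of_kernel_eq_on_srcCount` — a COPY-PRESERVING substitution `T′` (`T′ (x,s) (y,t) = 0` for `s ≠ t`) reads, at an output string with
  `s` source legs, only input strings with `s` source legs; `sum_lowSource_norm_kernel_map_le` — hence the pinned profile of `map T′ X` on the strings with
  `1 ≤ #src ≤ 2` is `≤ aⁿ·a·N₁₂` (k3c4-p1's pushforward p549016 applied to the middle truncation `srcTrunc 3 X − srcTrunc 1 X`), `a` = column/row mass of `T′`,
  `N₁₂` = the pinned `1 ≤ #src ≤ 2` profile of `X`;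
* §2 **`sum_lowSource_norm_kernel_scale_le`** — ONE SCALE: for `Ã` even without constant part on `Γ₁ × Fin 2`, in-band part `A₀ = S_{𝟙₀}Ã` (profile `N₀`,
  smallness with a source weight `0 < c ≤ 1`: `θ_c = eα(‖N₀‖_h + c‖N_B‖_h)/κ² < 1`), source part `B = Ã − A₀` (profile `N_B`, ANY size), spectator covariance
  `C′` of a replica-Gram-bounded `C`, and a copy-preserving substitution `T′` of mass `a`:
  `Σ_{W′ : W′_i = w′, 1 ≤ #src W′ ≤ 2} ‖kernel_m (srcTrunc 3 (map T′ (effAction C′ Ã))) W′‖ ≤ a^{m−1}·a·(c²)⁻¹·ρ^{−m}·e‖S_cB‖_h/(1−θ_c)²`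
  (`‖S_cB‖_h ≤ c‖N_B‖_h`; the step is p566327 `sum_norm_kernel_effAction_lowSource_le`, the truncation costs nothing: `kernel_srcTrunc_of_lt`).

Iterating §2 over `j` (label types changing with `j`, in-band data from the tower at every scale, `c_j ≍ κ_j²(1−θ_j)/(2eα_j P_j)`) gives the source profiles
`P_{j+1} ≤ a_j^{m}·(c_j²)⁻¹·ρ_j^{−m}·e·c_j‖N_B^j‖_h/(1−θ)²` — L-free at fixed `(β, U)`, which is all the rate-free VL needs.  Proofs only; no definition.
References: BGM 2006 §2.9 (4.3)–(4.10a); Salmhofer 1999 §4.3.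
-/

noncomputable section

namespace Summit.HubbardSuperconductivity.HubbardSuperconductivity.Theorems.TwoVolumeDefect

set_option linter.dupNamespace false -- summit = problem name (single-conjunct summit), D-0017

open Finset Literature.MathematicalPhysics.QuantumLattice GrassmannAlgebra Literature.Probability.LatticeModels
open scoped Nat

universe u

/-! ## §1 Copy-preserving substitutions read source counts exactly -/

section CopyPreserving

variable {𝕜 : Type*} [RCLike 𝕜] {Γ₁ Γ₂ : Type*} [Fintype Γ₁] [DecidableEq Γ₁] [Fintype Γ₂] [DecidableEq Γ₂]

omit [Fintype Γ₁] [DecidableEq Γ₁] in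
/-- Kernels of a difference (restated locally; cf. `GrassmannDefectSplit.kernel_sub'`). [folklore] -/
theorem kernel_sub_apply (X Y : GrassmannAlgebra 𝕜 (Γ₁ × Fin 2)) (m : ℕ) (W : Fin m → Γ₁ × Fin 2) :
    kernel 𝕜 (X - Y) m W = kernel 𝕜 X m W - kernel 𝕜 Y m W := by
  rw [sub_eq_add_neg, kernel_add, ← neg_one_smul 𝕜 Y, kernel_smul]
  ring

omit [Fintype Γ₁] [DecidableEq Γ₁] [Fintype Γ₂] [DecidableEq Γ₂] in
/-- For a copy-preserving substitution, a nonzero leg product forces equal source counts. [folklore] -/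
theorem srcCount_eq_of_prod_ne_zero (T' : Matrix (Γ₂ × Fin 2) (Γ₁ × Fin 2) 𝕜) (hT : ∀ x s y t, s ≠ t → T' (x, s) (y, t) = 0)
    {m : ℕ} (W' : Fin m → Γ₂ × Fin 2) (W : Fin m → Γ₁ × Fin 2) (h : ∏ i, T' (W' i) (W i) ≠ 0) :
    srcCount (fun p : Γ₁ × Fin 2 => p.2 = 1) W = srcCount (fun p : Γ₂ × Fin 2 => p.2 = 1) W' := by
  have hcopy : ∀ i, (W i).2 = (W' i).2 := by
    intro i
    by_contra hne
    apply h
    refine prod_eq_zero (mem_univ i) ?_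
    have := hT (W' i).1 (W' i).2 (W i).1 (W i).2 (Ne.symm hne)
    simpa using this
  unfold srcCount
  congr 1
  ext i
  simp [hcopy i]

omit [Fintype Γ₂] [DecidableEq Γ₂] in
/-- **A copy-preserving substitution reads, at an output string, only the input strings with the same source count**: if `X`, `X′` have
equal kernels at every string with `srcCount = srcCount W′`, then `kernel (map T′ X) m W′ = kernel (map T′ X′) m W′`. [folklore] -/
theorem kernel_map_eq_of_kernel_eq_on_srcCount (T' : Matrix (Γ₂ × Fin 2) (Γ₁ × Fin 2) 𝕜)
    (hT : ∀ x s y t, s ≠ t → T' (x, s) (y, t) = 0) (X X' : GrassmannAlgebra 𝕜 (Γ₁ × Fin 2)) {m : ℕ} (W' : Fin m → Γ₂ × Fin 2)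
    (h : ∀ W : Fin m → Γ₁ × Fin 2, srcCount (fun p : Γ₁ × Fin 2 => p.2 = 1) W = srcCount (fun p : Γ₂ × Fin 2 => p.2 = 1) W' →
      kernel 𝕜 X m W = kernel 𝕜 X' m W) :
    kernel 𝕜 (ExteriorAlgebra.map (Matrix.toLin' T') X) m W' = kernel 𝕜 (ExteriorAlgebra.map (Matrix.toLin' T') X') m W' := by
  rw [kernel_map, kernel_map]
  refine sum_congr rfl fun W _ => ?_
  simp only [LinearMap.toMatrix'_toLin']
  by_cases hz : ∏ i, T' (W' i) (W i) = 0
  · rw [hz, zero_mul, zero_mul]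
  · rw [h W (srcCount_eq_of_prod_ne_zero T' hT W' W hz)]

/-- **The low-source pinned profile of a pushforward**: for a copy-preserving `T′` with column mass `a` and row mass `a` at the pin, and an element
`X` whose pinned profile on the strings with `1 ≤ #src ≤ 2` (slot `p`, every pin) is `≤ N`, the pinned profile of `map T′ X` on the strings with
`1 ≤ #src ≤ 2` is `≤ aⁿ·(a·N)`. [cite: Salmhofer1999, Def. 2.19 (2.102)-(2.106)] -/
theorem sum_lowSource_norm_kernel_map_le (T' : Matrix (Γ₂ × Fin 2) (Γ₁ × Fin 2) 𝕜) (hT : ∀ x s y t, s ≠ t → T' (x, s) (y, t) = 0)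
    (X : GrassmannAlgebra 𝕜 (Γ₁ × Fin 2)) {n : ℕ} (p : Fin (n + 1)) (w' : Γ₂ × Fin 2)
    {a N : ℝ} (ha : 0 ≤ a) (hN0 : 0 ≤ N) (hcol : ∀ y', ∑ x', ‖T' x' y'‖ ≤ a) (hrow : ∑ y', ‖T' w' y'‖ ≤ a)
    (hN : ∀ y', ∑ Y ∈ univ.filter (fun Y : Fin (n + 1) → Γ₁ × Fin 2 =>
        Y p = y' ∧ 1 ≤ srcCount (fun q : Γ₁ × Fin 2 => q.2 = 1) Y ∧ srcCount (fun q : Γ₁ × Fin 2 => q.2 = 1) Y ≤ 2), ‖kernel 𝕜 X (n + 1) Y‖ ≤ N) :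
    ∑ W' ∈ univ.filter (fun W' : Fin (n + 1) → Γ₂ × Fin 2 =>
        W' p = w' ∧ 1 ≤ srcCount (fun q : Γ₂ × Fin 2 => q.2 = 1) W' ∧ srcCount (fun q : Γ₂ × Fin 2 => q.2 = 1) W' ≤ 2),
      ‖kernel 𝕜 (ExteriorAlgebra.map (Matrix.toLin' T') X) (n + 1) W'‖ ≤ a ^ n * (a * N) := by
  classical
  -- the middle truncation `X₁₂ := srcTrunc 3 X − srcTrunc 1 X` agrees with `X` exactly on the strings with `1 ≤ #src ≤ 2` and vanishes elsewhere
  set P₁ : Γ₁ × Fin 2 → Prop := fun q => q.2 = 1 with hP₁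
  set X₁₂ : GrassmannAlgebra 𝕜 (Γ₁ × Fin 2) := srcTrunc 𝕜 P₁ 3 X - srcTrunc 𝕜 P₁ 1 X with hX₁₂
  have hk₁₂ : ∀ (m : ℕ) (W : Fin m → Γ₁ × Fin 2), kernel 𝕜 X₁₂ m W =
      if 1 ≤ srcCount P₁ W ∧ srcCount P₁ W ≤ 2 then kernel 𝕜 X m W else 0 := by
    intro m W
    rw [hX₁₂, kernel_sub_apply, kernel_srcTrunc, kernel_srcTrunc]
    by_cases h1 : 1 ≤ srcCount P₁ W <;> by_cases h2 : srcCount P₁ W ≤ 2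
    · rw [if_pos (by omega), if_neg (by omega), if_pos ⟨h1, h2⟩, sub_zero]
    · rw [if_neg (by omega), if_neg (by omega), if_neg (fun h => h2 h.2), sub_zero]
    · rw [if_pos (by omega), if_pos (by omega), if_neg (fun h => h1 h.1), sub_self]
    · omega
  -- on the low-source output strings `map T′ X` and `map T′ X₁₂` agree
  have hagree : ∀ W' : Fin (n + 1) → Γ₂ × Fin 2, 1 ≤ srcCount (fun q : Γ₂ × Fin 2 => q.2 = 1) W' →
      srcCount (fun q : Γ₂ × Fin 2 => q.2 = 1) W' ≤ 2 →
      kernel 𝕜 (ExteriorAlgebra.map (Matrix.toLin' T') X) (n + 1) W' = kernel 𝕜 (ExteriorAlgebra.map (Matrix.toLin' T') X₁₂) (n + 1) W' := by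
    intro W' h1 h2
    refine kernel_map_eq_of_kernel_eq_on_srcCount T' hT X X₁₂ W' fun W hW => ?_
    rw [hk₁₂, if_pos (by rw [hW]; exact ⟨h1, h2⟩)]
  -- the full pinned profile of `X₁₂` is the low-source profile of `X`
  have hND : ∀ y', ∑ Y ∈ univ.filter (fun Y : Fin (n + 1) → Γ₁ × Fin 2 => Y p = y'), ‖kernel 𝕜 X₁₂ (n + 1) Y‖ ≤ N := by
    intro y'
    calc ∑ Y ∈ univ.filter (fun Y : Fin (n + 1) → Γ₁ × Fin 2 => Y p = y'), ‖kernel 𝕜 X₁₂ (n + 1) Y‖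
        = ∑ Y ∈ univ.filter (fun Y : Fin (n + 1) → Γ₁ × Fin 2 => Y p = y'),
            (if 1 ≤ srcCount P₁ Y ∧ srcCount P₁ Y ≤ 2 then ‖kernel 𝕜 X (n + 1) Y‖ else 0) :=
          sum_congr rfl fun Y _ => by rw [hk₁₂]; split_ifs <;> simp
      _ = ∑ Y ∈ univ.filter (fun Y : Fin (n + 1) → Γ₁ × Fin 2 => Y p = y' ∧ 1 ≤ srcCount P₁ Y ∧ srcCount P₁ Y ≤ 2),
            ‖kernel 𝕜 X (n + 1) Y‖ := by
          rw [← sum_filter]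
          congr 1
          ext Y
          simp only [mem_filter, mem_univ, true_and]
      _ ≤ N := hN y'
  calc ∑ W' ∈ univ.filter (fun W' : Fin (n + 1) → Γ₂ × Fin 2 =>
          W' p = w' ∧ 1 ≤ srcCount (fun q : Γ₂ × Fin 2 => q.2 = 1) W' ∧ srcCount (fun q : Γ₂ × Fin 2 => q.2 = 1) W' ≤ 2),
        ‖kernel 𝕜 (ExteriorAlgebra.map (Matrix.toLin' T') X) (n + 1) W'‖
      = ∑ W' ∈ univ.filter (fun W' : Fin (n + 1) → Γ₂ × Fin 2 =>
          W' p = w' ∧ 1 ≤ srcCount (fun q : Γ₂ × Fin 2 => q.2 = 1) W' ∧ srcCount (fun q : Γ₂ × Fin 2 => q.2 = 1) W' ≤ 2),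
        ‖kernel 𝕜 (ExteriorAlgebra.map (Matrix.toLin' T') X₁₂) (n + 1) W'‖ :=
        sum_congr rfl fun W' hW' => by
          obtain ⟨-, h1, h2⟩ := (mem_filter.1 hW').2
          rw [hagree W' h1 h2]
    _ ≤ ∑ W' ∈ univ.filter (fun W' : Fin (n + 1) → Γ₂ × Fin 2 => W' p = w'),
        ‖kernel 𝕜 (ExteriorAlgebra.map (Matrix.toLin' T') X₁₂) (n + 1) W'‖ :=
        sum_le_sum_of_subset_of_nonneg (fun W' hW' => mem_filter.2 ⟨mem_univ _, (mem_filter.1 hW').2.1⟩) fun _ _ _ => norm_nonneg _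
    _ ≤ a ^ n * (a * N) := sum_pinned_norm_kernel_map_le T' X₁₂ p w' ha hN0 hcol hrow hND

end CopyPreserving

/-! ## §2 One scale: step ∘ substitution ∘ truncation -/

section Scale

variable {𝕜 : Type*} [RCLike 𝕜] {Γ₁ : Type u} [Fintype Γ₁] [DecidableEq Γ₁] {Γ₂ : Type*} [Fintype Γ₂] [DecidableEq Γ₂]
  (C : Matrix Γ₁ Γ₁ 𝕜) (C' : Matrix (Γ₁ × Fin 2) (Γ₁ × Fin 2) 𝕜)
  (hC' : ∀ p q, C' p q = if p.2 = 0 ∧ q.2 = 0 then C p.1 q.1 else 0)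
include hC'

/-- **ONE SCALE OF THE SOURCE-PROFILE TOWER.**  Input: `Ã` even without constant part on `Γ₁ × Fin 2`, its in-band part `A₀ = S_{𝟙₀}Ã` (profile `N₀`)
and source part `B = Ã − A₀` (profile `N_B`, every kernel with a source leg), a source weight `0 < c ≤ 1` with `θ_c = eα(‖N₀‖_h + c‖N_B‖_h)/κ² < 1`,
a copy-preserving substitution `T′` into the next labels with mass `a`.  Output: the pinned profile of `srcTrunc 3 (map T′ (effAction C′ Ã))` on the
strings with `1 ≤ #src ≤ 2` is `≤ a^{m−1}·a·(c²)⁻¹·ρ^{−m}·e‖S_cB‖_h/(1−θ_c)²` — the source profile at the next scale from the source profile at this scale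
with in-band constants only. [cite: BenfattoGiulianiMastropietro2006, §2.9 (4.3)-(4.10a)] -/
theorem sum_lowSource_norm_kernel_scale_le {κ : ℝ} (hκ : 0 < κ) (hGB : IsGramBoundedR C κ)
    (c₀ : Γ₁ × Fin 2 → 𝕜) (hc₀ : ∀ p : Γ₁ × Fin 2, c₀ p = if p.2 = 0 then 1 else 0)
    (A : GrassmannAlgebra 𝕜 (Γ₁ × Fin 2)) (hAe : A ∈ evenPart 𝕜 (Γ₁ × Fin 2)) (hA0 : constPart 𝕜 A = 0)
    (N₀ NB : ℕ → ℝ) (hN₀0 : ∀ m', 0 ≤ N₀ m') (hNB0 : ∀ m', 0 ≤ NB m')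
    (hN₀ : ∀ m' (j : Fin (2 * m')) (w : Γ₁ × Fin 2), ∑ W ∈ univ.filter (fun W : Fin (2 * m') → Γ₁ × Fin 2 => W j = w),
      ‖kernel 𝕜 (ExteriorAlgebra.map (LinearMap.mulLeft 𝕜 c₀) A) (2 * m') W‖ ≤ N₀ m')
    (hNB : ∀ m' (j : Fin (2 * m')) (w : Γ₁ × Fin 2), ∑ W ∈ univ.filter (fun W : Fin (2 * m') → Γ₁ × Fin 2 => W j = w),
      ‖kernel 𝕜 (A - ExteriorAlgebra.map (LinearMap.mulLeft 𝕜 c₀) A) (2 * m') W‖ ≤ NB m')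
    {α : ℝ} (hα : 0 < α) (hrowC : ∀ X, ∑ Y, ‖C X Y‖ ≤ α) (hcolC : ∀ Y, ∑ X, ‖C X Y‖ ≤ α) {ρ : ℝ} (hρ : 0 < ρ)
    {c : ℝ} (hc0 : 0 < c) (hc1 : c ≤ 1)
    (hθ : Real.exp 1 * α * (normV (Γ₁ × Fin 2) κ ρ N₀ + normV (Γ₁ × Fin 2) κ ρ (fun m' => c * NB m')) / κ ^ 2 < 1)
    (T' : Matrix (Γ₂ × Fin 2) (Γ₁ × Fin 2) 𝕜) (hT : ∀ x s y t, s ≠ t → T' (x, s) (y, t) = 0)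
    {a : ℝ} (ha : 0 ≤ a) (hcolT : ∀ y', ∑ x', ‖T' x' y'‖ ≤ a) (hrowT : ∀ x', ∑ y', ‖T' x' y'‖ ≤ a)
    {n : ℕ} (p : Fin (n + 1)) (w' : Γ₂ × Fin 2) :
    ∑ W' ∈ univ.filter (fun W' : Fin (n + 1) → Γ₂ × Fin 2 =>
        W' p = w' ∧ 1 ≤ srcCount (fun q : Γ₂ × Fin 2 => q.2 = 1) W' ∧ srcCount (fun q : Γ₂ × Fin 2 => q.2 = 1) W' ≤ 2),
      ‖kernel 𝕜 (srcTrunc 𝕜 (fun q : Γ₂ × Fin 2 => q.2 = 1) 3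
        (ExteriorAlgebra.map (Matrix.toLin' T') (effAction 𝕜 C' A))) (n + 1) W'‖ ≤
      a ^ n * (a * ((c ^ 2)⁻¹ * (ρ⁻¹ ^ (n + 1) * (Real.exp 1 * normV (Γ₁ × Fin 2) κ ρ (fun m' => c * NB m')) /
        (1 - Real.exp 1 * α * (normV (Γ₁ × Fin 2) κ ρ N₀ + normV (Γ₁ × Fin 2) κ ρ (fun m' => c * NB m')) / κ ^ 2) ^ 2))) := by
  classical
  -- split `A = A₀ + B`
  set A₀ := ExteriorAlgebra.map (LinearMap.mulLeft 𝕜 c₀) A with hA₀def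
  set B := A - A₀ with hBdef
  have hsplit : A₀ + B = A := by rw [hBdef]; abel
  have hA₀e : A₀ ∈ evenPart 𝕜 (Γ₁ × Fin 2) := (mem_evenPart_iff).2 (map_mem_evenOdd_zero 𝕜 (LinearMap.mulLeft 𝕜 c₀) ((mem_evenPart_iff).1 hAe))
  have hBe : B ∈ evenPart 𝕜 (Γ₁ × Fin 2) := sub_mem hAe hA₀e
  have hA₀0 : constPart 𝕜 A₀ = 0 := by rw [hA₀def, constPart_map, hA0]
  have hB0 : constPart 𝕜 B = 0 := by rw [hBdef, map_sub, hA₀0, hA0, sub_zero]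
  -- every kernel of `B` carries a source leg: on source-free strings `kernel A₀ = kernel A`
  have hBsrc : ∀ (m : ℕ) (W : Fin m → Γ₁ × Fin 2), kernel 𝕜 B m W ≠ 0 → ∃ j, (W j).2 = 1 := by
    intro m W hW
    by_contra hno
    apply hW
    have hprod : ∏ i, c₀ (W i) = 1 := prod_eq_one fun i _ => by
      rw [hc₀]
      have : (W i).2 = 0 := by
        rcases Fin.exists_fin_two.1 ⟨(W i).2, rfl⟩ with h | h
        · exact h
        · exact absurd ⟨i, h⟩ hno
      rw [if_pos this]
    rw [hBdef, kernel_sub_apply, hA₀def, kernel_map_mulLeft, hprod, one_mul, sub_self]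
  -- the step: low-source profile of `effAction C′ A` at every pin
  have hstep : ∀ y' : Γ₁ × Fin 2, ∑ Y ∈ univ.filter (fun Y : Fin (n + 1) → Γ₁ × Fin 2 =>
      Y p = y' ∧ 1 ≤ srcCount (fun q : Γ₁ × Fin 2 => q.2 = 1) Y ∧ srcCount (fun q : Γ₁ × Fin 2 => q.2 = 1) Y ≤ 2),
      ‖kernel 𝕜 (effAction 𝕜 C' A) (n + 1) Y‖ ≤
      (c ^ 2)⁻¹ * (ρ⁻¹ ^ (n + 1) * (Real.exp 1 * normV (Γ₁ × Fin 2) κ ρ (fun m' => c * NB m')) /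
        (1 - Real.exp 1 * α * (normV (Γ₁ × Fin 2) κ ρ N₀ + normV (Γ₁ × Fin 2) κ ρ (fun m' => c * NB m')) / κ ^ 2) ^ 2) := by
    intro y'
    have h := sum_norm_kernel_effAction_lowSource_le C C' hC' hκ hGB c₀ hc₀ A B hA₀e hBe hA₀0 hB0 hBsrc N₀ NB hN₀0 hNB0 hN₀ hNB
      hα hrowC hcolC hρ hc0 hc1 hθ (Nat.succ_pos n) p y' 2
    rw [hsplit] at h
    exact h
  -- the truncation does not change the kernels on the strings with `≤ 2` source legs
  have htrunc : ∀ W' : Fin (n + 1) → Γ₂ × Fin 2, srcCount (fun q : Γ₂ × Fin 2 => q.2 = 1) W' ≤ 2 →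
      kernel 𝕜 (srcTrunc 𝕜 (fun q : Γ₂ × Fin 2 => q.2 = 1) 3 (ExteriorAlgebra.map (Matrix.toLin' T') (effAction 𝕜 C' A))) (n + 1) W' =
        kernel 𝕜 (ExteriorAlgebra.map (Matrix.toLin' T') (effAction 𝕜 C' A)) (n + 1) W' :=
    fun W' h2 => kernel_srcTrunc_of_lt 𝕜 _ _ (by omega)
  have hR0 : 0 ≤ (c ^ 2)⁻¹ * (ρ⁻¹ ^ (n + 1) * (Real.exp 1 * normV (Γ₁ × Fin 2) κ ρ (fun m' => c * NB m')) /
      (1 - Real.exp 1 * α * (normV (Γ₁ × Fin 2) κ ρ N₀ + normV (Γ₁ × Fin 2) κ ρ (fun m' => c * NB m')) / κ ^ 2) ^ 2) := by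
    have := normV_nonneg (Γ := Γ₁ × Fin 2) hκ.le hρ.le (N := fun m' => c * NB m') (fun m' => mul_nonneg hc0.le (hNB0 m'))
    positivity
  calc ∑ W' ∈ univ.filter (fun W' : Fin (n + 1) → Γ₂ × Fin 2 =>
          W' p = w' ∧ 1 ≤ srcCount (fun q : Γ₂ × Fin 2 => q.2 = 1) W' ∧ srcCount (fun q : Γ₂ × Fin 2 => q.2 = 1) W' ≤ 2),
        ‖kernel 𝕜 (srcTrunc 𝕜 (fun q : Γ₂ × Fin 2 => q.2 = 1) 3 (ExteriorAlgebra.map (Matrix.toLin' T') (effAction 𝕜 C' A))) (n + 1) W'‖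
      = ∑ W' ∈ univ.filter (fun W' : Fin (n + 1) → Γ₂ × Fin 2 =>
          W' p = w' ∧ 1 ≤ srcCount (fun q : Γ₂ × Fin 2 => q.2 = 1) W' ∧ srcCount (fun q : Γ₂ × Fin 2 => q.2 = 1) W' ≤ 2),
        ‖kernel 𝕜 (ExteriorAlgebra.map (Matrix.toLin' T') (effAction 𝕜 C' A)) (n + 1) W'‖ :=
        sum_congr rfl fun W' hW' => by rw [htrunc W' (mem_filter.1 hW').2.2.2]
    _ ≤ _ := sum_lowSource_norm_kernel_map_le T' hT (effAction 𝕜 C' A) p w' ha hR0 hcolT (hrowT w') hstep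

end Scale

/-! ## §3. Row-determined kernels (the dictionary for block analysis matrices)

For a substitution `map (toLin' E)`, the kernel at a string `W` depends on `E` only through the rows
`E (W i)` (`kernel_map`).  Hence (i) two block analysis matrices — e.g. the doubled analysis of the
augmented chain and the plain analysis `sectorAnalysisMatrix trivialMultiplier` — have equal kernels at
strings whose rows agree, across different label types; (ii) a string through a dead row (a source copy
parked in an unused sector slot) has kernel `0`.  With `kernel_map_sectorAnalysis` this identifies the
all-source kernels of the augmented last-scale object with `ε_x^m ·` the plainly sectorised kernels read by
the last-scale doors (`…VolumeLimitLastScaleWeightedDualDoor`, `…LastScaleUnits`). -/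

section Rows

variable {𝕜 : Type*} [RCLike 𝕜] {Γ₁ Γ₂ Γ₃ : Type*} [Fintype Γ₁] [DecidableEq Γ₁] [Fintype Γ₂]
  [DecidableEq Γ₂] [Fintype Γ₃] [DecidableEq Γ₃]

omit [Fintype Γ₂] [DecidableEq Γ₂] [Fintype Γ₃] [DecidableEq Γ₃] in
/-- **Rows determine kernels.**  If the rows of `E` along `W` equal the rows of `E'` along `W'`, then
`kernel (map (toLin' E) X) m W = kernel (map (toLin' E') X) m W'` (label types may differ). -/
theorem kernel_map_toLin'_eq_of_rows_eq (E : Matrix Γ₂ Γ₁ 𝕜) (E' : Matrix Γ₃ Γ₁ 𝕜)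
    (X : GrassmannAlgebra 𝕜 Γ₁) (m : ℕ) (W : Fin m → Γ₂) (W' : Fin m → Γ₃)
    (h : ∀ i, E (W i) = E' (W' i)) :
    kernel 𝕜 (ExteriorAlgebra.map (Matrix.toLin' E) X) m W =
      kernel 𝕜 (ExteriorAlgebra.map (Matrix.toLin' E') X) m W' := by
  rw [kernel_map, kernel_map]
  refine Finset.sum_congr rfl fun Y _ => ?_
  simp only [LinearMap.toMatrix'_toLin', h]

omit [Fintype Γ₂] [DecidableEq Γ₂] [Fintype Γ₃] [DecidableEq Γ₃] in
/-- **A dead row kills the kernel.**  If some leg of `W` sits on a zero row of `E`, then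
`kernel (map (toLin' E) X) m W = 0`. -/
theorem kernel_map_toLin'_eq_zero_of_row_eq_zero (E : Matrix Γ₂ Γ₁ 𝕜) (X : GrassmannAlgebra 𝕜 Γ₁)
    (m : ℕ) (W : Fin m → Γ₂) {i : Fin m} (h : E (W i) = 0) :
    kernel 𝕜 (ExteriorAlgebra.map (Matrix.toLin' E) X) m W = 0 := by
  rw [kernel_map]
  refine Finset.sum_eq_zero fun Y _ => ?_
  rw [LinearMap.toMatrix'_toLin',
    Finset.prod_eq_zero (Finset.mem_univ i) (by rw [h]; rfl), zero_mul]

omit [Fintype Γ₃] [DecidableEq Γ₃] in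
/-- **Pinned sums through dead rows vanish.**  If the pin `w` is a zero row of `E`, every pinned kernel sum
at `w` is `0` (so any profile budget `0 ≤ S` is met there trivially). -/
theorem sum_norm_kernel_map_toLin'_eq_zero_of_row_eq_zero (E : Matrix Γ₂ Γ₁ 𝕜)
    (X : GrassmannAlgebra 𝕜 Γ₁) (m : ℕ) (i : Fin m) (w : Γ₂) (h : E w = 0) (p : (Fin m → Γ₂) → Prop)
    [DecidablePred p] (g : (Fin m → Γ₂) → ℝ) :
    ∑ W ∈ (Finset.univ.filter fun W : Fin m → Γ₂ => W i = w ∧ p W),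
      g W * ‖kernel 𝕜 (ExteriorAlgebra.map (Matrix.toLin' E) X) m W‖ = 0 := by
  refine Finset.sum_eq_zero fun W hW => ?_
  have hWi : W i = w := ((Finset.mem_filter.mp hW).2).1
  rw [kernel_map_toLin'_eq_zero_of_row_eq_zero E X m W (i := i) (by rw [hWi, h]), norm_zero, mul_zero]

omit [Fintype Γ₃] [DecidableEq Γ₃] in
/-- **Rows determine pinned sums** (same label type, relabelled strings).  If `e : Γ₂ → Γ₂` satisfies
`E' (e q) = E q` for all `q`, is injective, and maps the pin class `{W | W i = w ∧ p W}` into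
`{W' | W' i = e w ∧ p' W'}`, then the pinned norm sum of `map (toLin' E) X` at `w` is at most that of
`map (toLin' E') X` at `e w` (nonnegative weights `g' ∘ (e ∘ ·) = g`). -/
theorem sum_norm_kernel_map_toLin'_le_of_rows (E E' : Matrix Γ₂ Γ₁ 𝕜) (X : GrassmannAlgebra 𝕜 Γ₁)
    (m : ℕ) (i : Fin m) (w : Γ₂) (e : Γ₂ → Γ₂) (he : Function.Injective e)
    (hrow : ∀ q, E' (e q) = E q) (p p' : (Fin m → Γ₂) → Prop) [DecidablePred p] [DecidablePred p']
    (hp : ∀ W, p W → p' (e ∘ W)) (g g' : (Fin m → Γ₂) → ℝ) (hg : ∀ W, g' (e ∘ W) = g W)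
    (hg' : ∀ W, 0 ≤ g' W) :
    ∑ W ∈ (Finset.univ.filter fun W : Fin m → Γ₂ => W i = w ∧ p W),
        g W * ‖kernel 𝕜 (ExteriorAlgebra.map (Matrix.toLin' E) X) m W‖ ≤
      ∑ W' ∈ (Finset.univ.filter fun W' : Fin m → Γ₂ => W' i = e w ∧ p' W'),
        g' W' * ‖kernel 𝕜 (ExteriorAlgebra.map (Matrix.toLin' E') X) m W'‖ := by
  have hinj : Function.Injective fun W : Fin m → Γ₂ => e ∘ W :=
    fun W₁ W₂ hW => funext fun j => he (congrFun hW j)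
  calc ∑ W ∈ (Finset.univ.filter fun W : Fin m → Γ₂ => W i = w ∧ p W),
          g W * ‖kernel 𝕜 (ExteriorAlgebra.map (Matrix.toLin' E) X) m W‖
        = ∑ W ∈ (Finset.univ.filter fun W : Fin m → Γ₂ => W i = w ∧ p W),
          g' (e ∘ W) * ‖kernel 𝕜 (ExteriorAlgebra.map (Matrix.toLin' E') X) m (e ∘ W)‖ := by
            refine Finset.sum_congr rfl fun W _ => ?_
            rw [hg W, kernel_map_toLin'_eq_of_rows_eq E E' X m W (e ∘ W) fun j => (hrow (W j)).symm]
    _ = ∑ W' ∈ (Finset.univ.filter fun W : Fin m → Γ₂ => W i = w ∧ p W).image (fun W => e ∘ W),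
          g' W' * ‖kernel 𝕜 (ExteriorAlgebra.map (Matrix.toLin' E') X) m W'‖ := by
            rw [Finset.sum_image fun W₁ _ W₂ _ hW => hinj hW]
    _ ≤ ∑ W' ∈ (Finset.univ.filter fun W' : Fin m → Γ₂ => W' i = e w ∧ p' W'),
          g' W' * ‖kernel 𝕜 (ExteriorAlgebra.map (Matrix.toLin' E') X) m W'‖ := by
            refine Finset.sum_le_sum_of_subset_of_nonneg ?_ fun W' _ _ =>
              mul_nonneg (hg' W') (norm_nonneg _)
            intro W' hW'
            obtain ⟨W, hW, rfl⟩ := Finset.mem_image.mp hW'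
            have hW2 := (Finset.mem_filter.mp hW).2
            refine Finset.mem_filter.mpr ⟨Finset.mem_univ _, ?_, hp W hW2.2⟩
            show e (W i) = e w
            rw [hW2.1]

end Rows

end Summit.HubbardSuperconductivity.HubbardSuperconductivity.Theorems.TwoVolumeDefect
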